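import Summits.SmoothPoincare4.SmoothPoincare4.Theses.SchoenfliesSplit
import Literature.Topology.FourManifolds.BallGluingUniqueness
import Literature.Topology.FourManifolds.RadialExtension
import Literature.Topology.FourManifolds.CerfPropositionFour
import Literature.Topology.FourManifolds.SmaleDiffDiscFamilies
import Literature.Geometry.Symplectic.GromovR4RelEndProofs

/-!
# Sketch — crux-ideate stmt-SmoothPoincare4-8758 (SchsplitCerf), round 1, ideator 2

First lemmas of the three crux idea cards (signatures; `sorry` only inside the first lemmas —
this is a sketch, not a proposal), plus the sorry-free compositions showing each line concludes
the crux BY NAME. Everything is stated over existing declarations.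

* Card A `contact-cone-gromov-relend`: `extendsOverBall_of_isSymplecticCone`, `schsplitCerf_of_lineA`.
* Card B `transverse-position-combing`: `diffeotopicToId_of_inTransversePosition`, `schsplitCerf_of_lineB`.
* Card C `cerf-covering-section`: `cerf_apex_of_loopAlexanderShell`, `schsplitCerf_of_lineC`.
-/

set_option linter.dupNamespace false

noncomputable section

open scoped Manifold ContDiff Topology
open Set Function Metric

namespace Summit.SmoothPoincare4.SmoothPoincare4.Cruxes.SchsplitCerf.Sketch

open Literature.Topology.FourManifolds Literature.Geometry.Symplectic

local notation "E4" => EuclideanSpace ℝ (Fin 4)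
local notation "E3" => EuclideanSpace ℝ (Fin 3)
local notation "𝕊³" => (Metric.sphere (0 : EuclideanSpace ℝ (Fin 4)) 1)

/-! ## Card A — contact cone + Gromov's recognition of `ℝ⁴` relative at infinity -/

/-- The **cone** of a self-map `ψ` of `S³` rescaled by a positive function `h`:
`C(x) = ‖x‖ · h(x/‖x‖) · ψ(x/‖x‖)` (value `0` at `0`). For a contactomorphism `ψ` of the
standard contact sphere with `ψ*α₀ = f α₀`, `f > 0`, the choice `h = f^{-1/2}` makes `C` an exact
symplectomorphism of `(ℝ⁴ ∖ 0, ω₀ = dλ₀)`, `λ₀ = ½ Σ (xᵢ dyᵢ - yᵢ dxᵢ) = r² α₀`. -/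
def cone (ψ : 𝕊³ ≃ₘ⟮𝓡 3, 𝓡 3⟯ 𝕊³) (h : 𝕊³ → ℝ) (x : E4) : E4 :=
  (‖x‖ * h (radialProjection (sphereBasePoint 3) x)) •
    ((ψ (radialProjection (sphereBasePoint 3) x) : 𝕊³) : E4)

/-- `ψ` is a **positive contactomorphism in cone form**: `h` is smooth and positive and the cone
`C = cone ψ h` preserves the standard symplectic form `ω₀` of `ℝ⁴` at every `x ≠ 0` (honest
Fréchet derivative). Equivalent to: `ψ` is a coorientation-preserving contactomorphism of
`(S³, ξ_st)` with conformal factor `h⁻²`. -/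
def IsSymplecticCone (ψ : 𝕊³ ≃ₘ⟮𝓡 3, 𝓡 3⟯ 𝕊³) (h : 𝕊³ → ℝ) : Prop :=
  ContMDiff (𝓡 3) 𝓘(ℝ, ℝ) ∞ h ∧ (∀ x, 0 < h x) ∧
    ∀ x : E4, x ≠ 0 → ∀ v w : E4,
      stdSymplecticForm (fderiv ℝ (cone ψ h) x v) (fderiv ℝ (cone ψ h) x w) = stdSymplecticForm v w

/-- **First lemma of card A (size L).** Under Gromov's recognition of `ℝ⁴` relative at infinity
(tree named fact `gromov_recognitionR4_relEnd`, McDuff–Salamon 2017 Rem. 4.5.2 (viii)), a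
diffeomorphism of `S³` whose rescaled cone is an `ω₀`-symplectomorphism of `ℝ⁴ ∖ 0` extends over
`D⁴`. Proof sketch: apply the fact to `M = ℝ⁴`, `sf = stdSymplecticMForm`,
`K = {0} ∪ C⁻¹(B̄(0,1))` (compact, star-shaped), `ψ_fact = C`, `χ = cone ψ⁻¹ h'`; get
`Φ : ℝ⁴ ≃ₘ ℝ⁴` with `Φ = C` off a compact set; the conical rescaling `Φ_λ(x) = Φ(λx)/λ` agrees
with `C` on `{‖x‖ ≥ 1}` (degree-one homogeneity of `C`); a radial diffeomorphism `Θ` (identity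
near `0`) carries the star-shaped image `Φ_λ(𝔻⁴) = {ρ y : ρ ≤ h(ψ⁻¹ y)}` onto `𝔻⁴`; `Θ ∘ Φ_λ`
preserves `𝔻⁴` in both directions and equals `ψ` on `S³`; conclude by
`Diffeomorph.closedBallRestrict`. -/
theorem extendsOverBall_of_isSymplecticCone (hG : gromov_recognitionR4_relEnd)
    (ψ : 𝕊³ ≃ₘ⟮𝓡 3, 𝓡 3⟯ 𝕊³) (h : 𝕊³ → ℝ) (hψ : IsSymplecticCone ψ h) :
    ExtendsOverBall 3 ψ := by
  sorry

/-- **The contact input of card A** (Eliashberg 1992, Thm. 2.1.1 + Gray stability; Geiges 2008,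
Lemma 4.11.1 with Thm. 4.10.3), in orientation-free cone form: every self-diffeomorphism `φ` of
`S³` is diffeotopic to `ψ ∘ A` with `A` a linear isometry of `ℝ⁴` (a reflection if `φ` reverses
orientation, composed with complex conjugation if the contactomorphism reverses the
coorientation) and `ψ` a positive contactomorphism of `ξ_st` in cone form. Candidate NEW named
fact (not in the tree); XL on its own (tightness of `ξ_st` + uniqueness of the tight structure
on `S³`). -/
def EliashbergIsotopyToContactCone : Prop :=
  ∀ φ : 𝕊³ ≃ₘ⟮𝓡 3, 𝓡 3⟯ 𝕊³, ∃ (A : E4 ≃ₗᵢ[ℝ] E4) (ψ : 𝕊³ ≃ₘ⟮𝓡 3, 𝓡 3⟯ 𝕊³) (h : 𝕊³ → ℝ),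
    IsSymplecticCone ψ h ∧ Diffeomorph.IsDiffeotopic ((sphereCongr A).trans ψ) φ

/-- **Line A closes the crux** (sorry-free modulo the first lemma): Gromov rel. end + Eliashberg
⟹ every `φ` extends over `D⁴` (`ExtendsOverBall` is closed under `trans` and diffeotopy; linear
isometries extend) ⟹ `cerf_diffeomorph_sphere_three_extends_ball` ⟹ (tree,
`cerf_twistedSphere_four_of_extends''`) `cerf_twistedSphere_four` = `SchsplitCerf` verbatim. -/
theorem schsplitCerf_of_lineA (hG : gromov_recognitionR4_relEnd)
    (hE : EliashbergIsotopyToContactCone) :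
    Summit.SmoothPoincare4.SmoothPoincare4.Theses.SchoenfliesSplit.SchsplitCerf := by
  have hext : cerf_diffeomorph_sphere_three_extends_ball := by
    intro φ
    obtain ⟨A, ψ, h, hψ, hiso⟩ := hE φ
    exact ((extendsOverBall_sphereCongr (n := 3) A).trans
      (extendsOverBall_of_isSymplecticCone hG ψ h hψ)).of_isDiffeotopic hiso
  unfold Summit.SmoothPoincare4.SmoothPoincare4.Theses.SchoenfliesSplit.SchsplitCerf
  intro _ φ T
  exact cerf_twistedSphere_four_of_extends'' hext φ T

/-! ## Card B — transverse position of the image foliation (Hatcher-style native line) -/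

/-- `s` is **supported in the closed unit ball** (the tree's convention in
`UnitBallDiffeotopyTrivial` / `cerf_pi0DiffDisc_relBoundary_three`). -/
def SupportedInUnitBall (s : E3 ≃ₘ⟮𝓡 3, 𝓡 3⟯ E3) : Prop :=
  ∀ y : E3, 1 ≤ ‖y‖ → s y = y

/-- `s` is **diffeotopic to the identity through diffeomorphisms supported in the unit ball**
(the conclusion of `cerf_pi0DiffDisc_relBoundary_three` for `s`). -/
def UnitBallDiffeotopicToId (s : E3 ≃ₘ⟮𝓡 3, 𝓡 3⟯ E3) : Prop :=
  ∃ D : Diffeotopy (𝓡 3) E3, D.stage 1 = s ∧ ∀ t y, 1 ≤ ‖y‖ → D.toFun t y = y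

/-- **Transverse position**: the images under `s` of the horizontal planes `{y₂ = c}` are
transverse to the vertical slicing `{y₀ = a}` — equivalently the coordinate `y₀` restricted to
every image leaf has no critical point: at every point some horizontal direction `v` is carried by
`Ds` to a vector with non-zero `0`-th component. An OPEN first-order condition; it holds for
`s = id` (take `v = e₀`). -/
def InTransversePosition (s : E3 ≃ₘ⟮𝓡 3, 𝓡 3⟯ E3) : Prop :=
  ∀ y : E3, ∃ v : E3, v 2 = 0 ∧ (fderiv ℝ (fun z : E3 => s z) y v) 0 ≠ 0

/-- **First lemma of card B (endgame; size L; leans only on PROVED tree facts).** A diffeomorphism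
supported in the unit ball and in transverse position is diffeotopic to the identity through
diffeomorphisms supported in the unit ball. Proof sketch: `F = y₂ ∘ s⁻¹` restricted to each
vertical plane `Q_a = {y₀ = a}` is a boundary-standard submersion of the plane (its fibres are
lines: clopen argument on compact fibre components), conjugate to the height by a canonical
`σ_a ∈ Diff_c(Q_a)` (2-d flow conjugation along `∇F × ∇y₀`, 1-d transit-time correction),
smoothly in `a`, `σ_a = id` for `|a| ≥ 1`; `σ = (σ_a)` is slice-preserving with `F ∘ σ = y₂`,
so `m := s⁻¹ ∘ σ` is height-preserving and `s = σ ∘ m⁻¹`; the based loops `a ↦ σ_a`, `c ↦ m_c`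
in `Diff_c(ℝ²)` are null-homotopic by Smale's theorem in families
(`exists_nullhomotopy_of_unitBall_diffeotopy`, `exists_unitBall_diffeotopy_family`, PROVED in
`SmaleDiffDiscFamilies.lean`); compose and normalise supports as in
`UnitBallDiffeotopyTrivial.of_compact`. -/
theorem diffeotopicToId_of_inTransversePosition (s : E3 ≃ₘ⟮𝓡 3, 𝓡 3⟯ E3)
    (hs : SupportedInUnitBall s) (ht : InTransversePosition s) :
    UnitBallDiffeotopicToId s := by
  sorry

/-- **The heart of card B (transfer `C⁺`, XL — the Cerf content):** every diffeomorphism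
supported in the unit ball agrees, up to a unit-ball diffeotopy, with one in transverse position
("combing the image foliation": Alexander–Hatcher bulge surgery along the sections of the image
leaves with the vertical planes). True (take `s' = id`, by Cerf); the line must prove it without. -/
def TransversePositionReachable : Prop :=
  ∀ s : E3 ≃ₘ⟮𝓡 3, 𝓡 3⟯ E3, SupportedInUnitBall s →
    ∃ s' : E3 ≃ₘ⟮𝓡 3, 𝓡 3⟯ E3, SupportedInUnitBall s' ∧ InTransversePosition s' ∧
      UnitBallDiffeotopicToId (s'.symm.trans s)

/-- **Line B closes the crux** (sorry-free modulo the first lemma and the bookkeeping closure of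
unit-ball diffeotopies under composition, `hcomp`, which is `Diffeotopy.trans`-plumbing): reach
transverse position, finish by the endgame; this is the apex `cerf_pi0DiffDisc_relBoundary_three`
(definitionally `∀ s, SupportedInUnitBall s → UnitBallDiffeotopicToId s`), whence the crux by the
tree's proved chain `cerf_twistedSphere_four_of_relBoundary`. -/
theorem schsplitCerf_of_lineB (hT : TransversePositionReachable)
    (hcomp : ∀ a b : E3 ≃ₘ⟮𝓡 3, 𝓡 3⟯ E3, UnitBallDiffeotopicToId a → UnitBallDiffeotopicToId b →
      UnitBallDiffeotopicToId (a.trans b)) :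
    Summit.SmoothPoincare4.SmoothPoincare4.Theses.SchoenfliesSplit.SchsplitCerf := by
  have hapex : cerf_pi0DiffDisc_relBoundary_three := by
    intro s hs
    obtain ⟨s', hs', ht', hrel⟩ := hT s hs
    have h1 : UnitBallDiffeotopicToId s' := diffeotopicToId_of_inTransversePosition s' hs' ht'
    have h2 := hcomp _ _ h1 hrel
    have e : s'.trans (s'.symm.trans s) = s := by
      ext x
      simp
    rw [e] at h2
    exact h2
  unfold Summit.SmoothPoincare4.SmoothPoincare4.Theses.SchoenfliesSplit.SchsplitCerf
  intro _ φ T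
  exact cerf_twistedSphere_four_of_relBoundary hapex φ T

/-! ## Card C — Cerf's covering section (one-parameter Alexander theorem, by the book) -/

/-- **One-parameter Alexander theorem, shell form** (= Cerf 1968, Ch. I §2–3, statement (3):
the covering `ℛ` "3-discs with an isotopy class of parametrisation ↦ their boundary 2-sphere" is
trivial — here read on LOOPS, which is all the reduction needs): every smooth loop
`e_t` (`t ∈ ℝ`, 1-periodic, `e_0 = id`) of embeddings of the closed shell `{1 ≤ ‖y‖ ≤ 2} ⊂ ℝ³`
(injective with invertible derivative there) extends over the inner ball to a smooth LOOP `d_t` of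
embeddings of the closed ball of radius `2` agreeing with `e_t` on the shell, `d_0 = id`.
(Pointwise in `t` this is Alexander–Morse's smooth Schönflies theorem with collars; the absence of
monodromy around the loop is `π₀ Diff(D³ rel ∂) = 0`, the content of Ch. II–VI: codimension-one
stratification of height functions on spheres, Alexander addition, additive section by induction
on complexity.) -/
def LoopAlexanderShell : Prop :=
  ∀ e : ℝ → E3 → E3, ContDiff ℝ ∞ (fun p : ℝ × E3 => e p.1 p.2) → (∀ t, e (t + 1) = e t) →
    e 0 = id →
    (∀ t, Set.InjOn (e t) {y : E3 | 1 ≤ ‖y‖ ∧ ‖y‖ ≤ 2} ∧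
      ∀ y : E3, 1 ≤ ‖y‖ → ‖y‖ ≤ 2 → Function.Bijective (fderiv ℝ (e t) y)) →
    ∃ d : ℝ → E3 → E3, ContDiff ℝ ∞ (fun p : ℝ × E3 => d p.1 p.2) ∧ (∀ t, d (t + 1) = d t) ∧
      d 0 = id ∧
      (∀ t, Set.InjOn (d t) (Metric.closedBall (0 : E3) 2) ∧
        ∀ y ∈ Metric.closedBall (0 : E3) 2, Function.Bijective (fderiv ℝ (d t) y)) ∧
      ∀ t (y : E3), 1 ≤ ‖y‖ → ‖y‖ ≤ 2 → d t y = e t y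

/-- **First lemma of card C (Cerf Ch. I §3, "(3) ⟹ (2) ⟹ (2′)" in the tree's language;
size L).** Proof sketch: normalise `s` by a unit-ball diffeotopy so that `s 0 = 0`, `Ds(0) = 1`
(`LocalLinearisationIsotopy.lean` pattern); the rescaling path `e_τ(y) = s(τ y)/τ`
(`= ∫₀¹ Ds(σ τ y) y dσ`, smooth on `[0,1] × ℝ³`, `e_0 = id`, `e_1 = s`), reparametrised flat at
both ends, restricts on the shell `{1 ≤ ‖y‖ ≤ 2}` to a smooth LOOP (`s = id` off the unit ball);
`LoopAlexanderShell` spans it by a loop `d_τ` of balls; `g_τ := d_τ⁻¹ ∘ e_τ` is then a path of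
diffeomorphisms equal to the identity on the shell, i.e. supported in the unit ball, from
`g_0 = id` to `g_1 = d_1⁻¹ ∘ s = d_0⁻¹ ∘ s = s`. -/
theorem cerf_apex_of_loopAlexanderShell (h : LoopAlexanderShell) :
    cerf_pi0DiffDisc_relBoundary_three := by
  sorry

/-- **Line C closes the crux** (sorry-free modulo the first lemma), by the tree's proved chain. -/
theorem schsplitCerf_of_lineC (h : LoopAlexanderShell) :
    Summit.SmoothPoincare4.SmoothPoincare4.Theses.SchoenfliesSplit.SchsplitCerf := by
  unfold Summit.SmoothPoincare4.SmoothPoincare4.Theses.SchoenfliesSplit.SchsplitCerf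
  intro _ φ T
  exact cerf_twistedSphere_four_of_relBoundary (cerf_apex_of_loopAlexanderShell h) φ T

end Summit.SmoothPoincare4.SmoothPoincare4.Cruxes.SchsplitCerf.Sketch

end
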